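import Literature.Barriers.FinalStateConjecture.NonSmoothNullInfinityScattering
import Literature.Barriers.FinalStateConjecture.NonSmoothNullInfinityProofs
import Mathlib.Analysis.Calculus.FDeriv.Symmetric
import HarnessLib

/-!
# Barrier catalogue `FinalStateConjecture`: the linear scattering problem on Schwarzschild —
# discharges of the named ingredients of `KehrbergerLogarithmicAsymptoticsCorrected`
(`Literature/Barriers/FinalStateConjecture/`, D-0021, D-0014; family `gr`; companion of
`NonSmoothNullInfinityScattering.lean`, namespace `Literature.Barriers.FinalStateConjecture`)

`NonSmoothNullInfinityScattering.lean` vendors the ingredients of the proof of Kehrberger's Thm. 6.2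
(arXiv:2105.08079 = Ann. Henri Poincaré 23 (2022) 829–921) as named facts about the class
`IsScatteringSolution M r v₁ G ψ` (a smooth radiation field `ψ = rφ` of
`∂ᵤ∂ᵥ(rφ) = −2M(1 − 2M/r) rφ/r³`, eq. (6.14), vanishing for `v ≤ v₁`, attaining the data `G` on `𝓘⁻`
pointwise, `ψ(u, v) → G(v)` as `u → −∞`, and locally bounded towards the past), to be discharged
bottom-up in this sibling file (append protocol). This file **proves**

* `IsScatteringSolution.unique` and `SchwarzschildLinearScattering_unique_holds` — the discharge of
  the named fact `SchwarzschildLinearScattering_unique` ("there exists a unique smooth scattering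
  solution `φ` attaining these data", Kehrberger, Thm. 6.2, first paragraph, where uniqueness is
  "understood in the class of finite-energy solutions" after Dafermos–Rodnianski–Shlapentokh-Rothman):
  two scattering solutions with the same mass `M > 0`, EF area radius, initial advanced time `v₁` and
  data `G` coincide. It is a corollary of the uniqueness theorem already proved for the wider class
  of smooth radiation fields vanishing on `{v ≤ v₁}` with prescribed pointwise limits at `𝓘⁻`
  (`IsRadiationFieldOnSchwarzschild.unique`, `NonSmoothNullInfinityProofs.lean`: backward Grönwall for
  the null slice energies `∫_{v₁}^{b} (∂ᵥψ)²`, using `∫_{−∞}^{u} sup_v |V| < ∞` for the potential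
  `V = −2M(1 − 2M/r)/r³` towards `𝓘⁻`); in particular the local-boundedness clause of
  `IsScatteringSolution` is not needed for uniqueness (it is kept there because the other facts are
  stated for that class). No support or regularity hypothesis on `G` enters.

* `SchwarzschildLinearScattering_timeIntegral_holds` — the discharge of the named fact
  `SchwarzschildLinearScattering_timeIntegral`, **the time-integral identity `rφ = T(rφ^T)`,
  `T = ∂ᵤ + ∂ᵥ`** (proof of Thm. 6.2, eqs. (6.22)–(6.23)): if `ψ` is a scattering solution with data
  `G` on `𝓘⁻` and `ψT` one with data `G^T(v) = ∫_{v₁}^{v} G` (`scatteringTimeIntegral`), then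
  `ψ = ∂ᵤψT + ∂ᵥψT` everywhere. The proof is the printed one — "the solution `rφ^T` arising from this
  satisfies `T(rφ^T)(−∞, v) = ∂ᵥ(rφ^T)(−∞, v) = (G^T)'(v) = G(v)`. Therefore, since `T` also commutes
  with the wave equation, we indeed have `T(rφ^T) = rφ` by uniqueness" — assembled from:
  `IsRadiationFieldOnSchwarzschild.timeDeriv` (**`T` commutes with the wave equation**: for a smooth
  solution `ψ` of `∂ᵤ∂ᵥψ = Vψ`, `V = −2M(1 − 2M/r)/r³` (`efPotential`), `Tψ = ∂ᵤψ + ∂ᵥψ` is again one;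
  Schwarz's theorem for `ψ` and `∂ᵥψ` (`partialU_partialV_comm`, Mathlib's
  `ContDiffAt.isSymmSndFDerivAt`) gives `∂ᵤ∂ᵥ(Tψ) = ∂ᵤ(Vψ) + ∂ᵥ(Vψ) = (TV)ψ + V Tψ`, and `TV = 0`
  because `V` is a function of `r` and `∂ᵤr = −∂ᵥr`, `IsEFAreaRadius.hasDerivAt_efPotential`);
  `IsRadiationFieldOnSchwarzschild.partialU_eq_zero_of_le` / `partialV_eq_zero_of_le` (a radiation
  field vanishing on `{v ≤ v₁}` has `∂ᵤψ = ∂ᵥψ = 0` there, at `v = v₁` by continuity);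
  `IsScatteringSolution.tendsto_partialU_atBot` (**`∂ᵤ(rφ^T)(−∞, v) = 0`**: along `[v₁, v]`,
  `∂ᵥ(∂ᵤψ) = Vψ` is bounded by `K(u) B`, `K(u) = 2M/r(u, v₁)³ → 0` at `𝓘⁻` (`efPotentialBound`), `B`
  the past bound of the class, so `|∂ᵤψ(u, v)| ≤ (v − v₁) K(u) B → 0` by the mean value inequality —
  the one place where the local-boundedness clause of `IsScatteringSolution` is used);
  `IsScatteringSolution.tendsto_partialV_atBot` (**`∂ᵥ(rφ^T)(−∞, v) = (G^T)'(v)`**: the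
  backward-Grönwall estimates of `NonSmoothNullInfinityProofs.lean` — `nullSliceEnergy_bounded`,
  `abs_partialV_sub_le`: `|∂ᵥψ(u, x) − ∂ᵥψ(u', x)| ≤ W₀ (P(u) − P(u'))` for `u' ≤ u`, `P = efWeight → 0`
  — feed `abs_le_of_primitive_tendsto_zero` with `e = ∂ᵥψ − (G^T)'`, `F = ψ − G^T`, whence
  `|∂ᵥψ(u, x) − (G^T)'(x)| ≤ W₀ P(u) → 0`, "by the methods of the proof of Thm. 6.1"); and
  `IsRadiationFieldOnSchwarzschild.unique`. The hypothesis `∫ G = 0` of the fact (which makes `G^T`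
  again compactly supported, so that `ψT` exists by `SchwarzschildLinearScattering_exists`) is not
  needed for the identity itself and is not used.

The remaining facts of `NonSmoothNullInfinityScattering.lean` (`_exists`, `_futureLimit`, `_uDecay`,
`_logExpansion`) are NOT discharged here yet; their intended proofs are recorded in that file's
module docstring. When `_exists`, `_uDecay` and `_logExpansion` are discharged,
`KehrbergerLogarithmicAsymptoticsCorrected_holds := .of_facts ‹_› ‹_› ‹_›` lands in the last
discharging file (it cannot land in `NonSmoothNullInfinityScattering.lean` itself without an import
cycle).

## References

* L. M. A. Kehrberger, *The case against smooth null infinity I: heuristics and counter-examples*,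
  Ann. Henri Poincaré 23 (2022) 829–921 = arXiv:2105.08079 (v3, 2023), §6.2, Thm. 6.2 (first
  paragraph: existence and uniqueness of the scattering solution) with Thm. 6.1 and eq. (6.14);
  proof of Thm. 6.2, eqs. (6.22)–(6.23) (the time integral `G^T(v) = ∫_{v₁}^{v} G(v') dv'`,
  "`T(rφ^T)(−∞, v) = ∂ᵥ(rφ^T)(−∞, v) = (G^T)'(v) = G(v)` [...] since `T` also commutes with the wave
  equation, we indeed have `T(rφ^T) = rφ` by uniqueness"); §3.2 (`∂ᵥr = −∂ᵤr = 1 − 2M/r`). Key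
  `Kehrberger2022AHP`.
* M. Dafermos, I. Rodnianski, Y. Shlapentokh-Rothman, *A scattering theory for the wave equation on
  Kerr black hole exteriors*, Ann. Sci. ÉNS 51 (2018) 371–486 (the uniqueness class quoted by
  Kehrberger). Key `DafermosRodnianskiShlapentokhrothman2018`.
-/

noncomputable section

open Filter
open _root_.Topology

namespace Literature.Barriers.FinalStateConjecture

namespace IsScatteringSolution

variable {M : ℝ} {r : ℝ → ℝ → ℝ} {v₁ : ℝ} {G : ℝ → ℝ} {ψ₁ ψ₂ : ℝ → ℝ → ℝ}

/-- **Uniqueness of the scattering solution** (dot-notation form): for `M > 0` and an EF area radius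
`r`, two scattering solutions with the same initial advanced time `v₁` and the same data `G` on `𝓘⁻`
coincide — by `IsRadiationFieldOnSchwarzschild.unique` applied to the radiation fields `ψ₁, ψ₂`,
which vanish on `{v ≤ v₁}` and both tend to `G(v)` as `u → −∞`; the local boundedness clause is not
used. (Kehrberger, Thm. 6.2: "there exists a unique smooth scattering solution `φ` attaining these
data, with the uniqueness being understood in the class of finite-energy solutions".)
[cite: Kehrberger2022AHP, Thm. 6.2 (first paragraph)] -/
theorem unique (hM : 0 < M) (hr : IsEFAreaRadius M r) (h₁ : IsScatteringSolution M r v₁ G ψ₁)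
    (h₂ : IsScatteringSolution M r v₁ G ψ₂) : ψ₁ = ψ₂ :=
  IsRadiationFieldOnSchwarzschild.unique hM hr h₁.isRadiationField h₂.isRadiationField
    (fun _ _ hv ↦ h₁.eq_zero hv) (fun _ _ hv ↦ h₂.eq_zero hv) h₁.tendsto_atBot h₂.tendsto_atBot

end IsScatteringSolution

/-- **Discharge of the named fact `SchwarzschildLinearScattering_unique`** (D-0014): uniqueness of
the scattering solution of the spherically symmetric linear wave equation on Schwarzschild in the
class `IsScatteringSolution` — "there exists a unique smooth scattering solution `φ` attaining these
data" (Kehrberger, Thm. 6.2, first paragraph; there in the finite-energy class after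
Dafermos–Rodnianski–Shlapentokh-Rothman, here for smooth radiation fields vanishing on `{v ≤ v₁}`
with the prescribed pointwise limits at `𝓘⁻`, `IsRadiationFieldOnSchwarzschild.unique`).
[cite: Kehrberger2022AHP, Thm. 6.2 (first paragraph)] -/
theorem SchwarzschildLinearScattering_unique_holds : SchwarzschildLinearScattering_unique :=
  fun _M hM _r hr _G _v₁ _ψ₁ _ψ₂ h₁ h₂ ↦ h₁.unique hM hr h₂

/-! ## The time-integral identity `rφ = T(rφ^T)` (proof of Thm. 6.2, eqs. (6.22)–(6.23)) -/

open _root_.Set _root_.MeasureTheory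

/-! ### Calculus: slices of vector-valued maps on `ℝ²` and Schwarz's theorem for curried maps -/

section Calculus

variable {F' : Type*} [NormedAddCommGroup F'] [NormedSpace ℝ F']

/-- The slice `x ↦ F(x, y)` of a differentiable vector-valued `F : ℝ × ℝ → F'` has derivative
`DF(x,y)·(1,0)`. [folklore] -/
lemma hasDerivAt_slice_fst_vec {F : ℝ × ℝ → F'} {p : ℝ × ℝ} (hF : DifferentiableAt ℝ F p) :
    HasDerivAt (fun x ↦ F (x, p.2)) (fderiv ℝ F p (1, 0)) p.1 :=
  hF.hasFDerivAt.comp_hasDerivAt p.1 ((hasDerivAt_id p.1).prodMk (hasDerivAt_const p.1 p.2))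

/-- The slice `y ↦ F(x, y)` of a differentiable vector-valued `F : ℝ × ℝ → F'` has derivative
`DF(x,y)·(0,1)`. [folklore] -/
lemma hasDerivAt_slice_snd_vec {F : ℝ × ℝ → F'} {p : ℝ × ℝ} (hF : DifferentiableAt ℝ F p) :
    HasDerivAt (fun y ↦ F (p.1, y)) (fderiv ℝ F p (0, 1)) p.2 :=
  hF.hasFDerivAt.comp_hasDerivAt p.2 ((hasDerivAt_const p.2 p.1).prodMk (hasDerivAt_id p.2))

variable {ψ : ℝ → ℝ → ℝ}

/-- `∂ᵤ∂ᵥψ(u,v) = D²ψ(u,v)·(1,0)·(0,1)` for jointly smooth `ψ`. [folklore] -/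
lemma partialU_partialV_eq_fderiv_fderiv
    (hψ : ContDiff ℝ ((⊤ : ℕ∞) : WithTop ℕ∞) (Function.uncurry ψ)) (u v : ℝ) :
    partialU (partialV ψ) u v =
      fderiv ℝ (fderiv ℝ (Function.uncurry ψ)) (u, v) (1, 0) (0, 1) := by
  have hd : DifferentiableAt ℝ (fderiv ℝ (Function.uncurry ψ)) (u, v) :=
    ((contDiff_infty_iff_fderiv.1 hψ).2.differentiable (by simp)) (u, v)
  have hV : partialV ψ = fun u' v' ↦ fderiv ℝ (Function.uncurry ψ) (u', v') (0, 1) := by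
    funext u' v'
    exact partialV_eq_fderiv hψ u' v'
  rw [partialU, hV]
  have h := (hasDerivAt_slice_fst_vec (p := (u, v)) hd).clm_apply
    (hasDerivAt_const u (((0 : ℝ), (1 : ℝ)) : ℝ × ℝ))
  simp only [map_zero, add_zero] at h
  exact h.deriv

/-- `∂ᵥ∂ᵤψ(u,v) = D²ψ(u,v)·(0,1)·(1,0)` for jointly smooth `ψ`. [folklore] -/
lemma partialV_partialU_eq_fderiv_fderiv
    (hψ : ContDiff ℝ ((⊤ : ℕ∞) : WithTop ℕ∞) (Function.uncurry ψ)) (u v : ℝ) :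
    partialV (partialU ψ) u v =
      fderiv ℝ (fderiv ℝ (Function.uncurry ψ)) (u, v) (0, 1) (1, 0) := by
  have hd : DifferentiableAt ℝ (fderiv ℝ (Function.uncurry ψ)) (u, v) :=
    ((contDiff_infty_iff_fderiv.1 hψ).2.differentiable (by simp)) (u, v)
  have hU : partialU ψ = fun u' v' ↦ fderiv ℝ (Function.uncurry ψ) (u', v') (1, 0) := by
    funext u' v'
    exact partialU_eq_fderiv hψ u' v'
  rw [partialV, hU]
  have h := (hasDerivAt_slice_snd_vec (p := (u, v)) hd).clm_apply
    (hasDerivAt_const v (((1 : ℝ), (0 : ℝ)) : ℝ × ℝ))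
  simp only [map_zero, add_zero] at h
  exact h.deriv

/-- **Schwarz's theorem for curried smooth maps `ℝ → ℝ → ℝ`**: `∂ᵤ∂ᵥψ = ∂ᵥ∂ᵤψ`
(Mathlib's `ContDiffAt.isSymmSndFDerivAt`). [folklore] -/
theorem partialU_partialV_comm (hψ : ContDiff ℝ ((⊤ : ℕ∞) : WithTop ℕ∞) (Function.uncurry ψ))
    (u v : ℝ) : partialU (partialV ψ) u v = partialV (partialU ψ) u v := by
  rw [partialU_partialV_eq_fderiv_fderiv hψ, partialV_partialU_eq_fderiv_fderiv hψ]
  have h2 : minSmoothness ℝ 2 ≤ ((⊤ : ℕ∞) : WithTop ℕ∞) := by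
    rw [minSmoothness_of_isRCLikeNormedField]
    exact WithTop.coe_le_coe.2 le_top
  exact (hψ.contDiffAt.isSymmSndFDerivAt h2).eq (1, 0) (0, 1)

end Calculus

/-! ### `T = ∂ᵤ + ∂ᵥ` commutes with the wave equation -/

namespace IsEFAreaRadius

variable {M : ℝ} {r : ℝ → ℝ → ℝ}

/-- **`TV = 0`**: the potential `V = −2M(1 − 2M/r)/r³` is annihilated by `T = ∂ᵤ + ∂ᵥ`, because it
is a function of `r` alone and `∂ᵤr = −∂ᵥr` (the static Killing field `T = ∂ₜ` of Schwarzschild).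
Stated with explicit one-variable derivatives: there is a number `d` (namely `g'(r(u,v))` for
`V = g ∘ r`) with `∂ᵤV(u,v) = −d (1 − 2M/r)` and `∂ᵥV(u,v) = d (1 − 2M/r)`.
[cite: Kehrberger2022AHP, §3.2 and §6.2 eq. (6.14)] -/
lemma hasDerivAt_efPotential (hr : IsEFAreaRadius M r) (hM : 0 ≤ M) (u v : ℝ) :
    ∃ d : ℝ, HasDerivAt (fun u' ↦ efPotential M r u' v) (d * (-(1 - 2 * M / r u v))) u ∧
      HasDerivAt (fun v' ↦ efPotential M r u v') (d * (1 - 2 * M / r u v)) v := by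
  have hρ : r u v ≠ 0 := (hr.pos hM u v).ne'
  have hgd : DifferentiableAt ℝ (fun ρ : ℝ ↦ -2 * M * (1 - 2 * M / ρ) / ρ ^ 3) (r u v) := by
    fun_prop (disch := simp [hρ])
  refine ⟨deriv (fun ρ : ℝ ↦ -2 * M * (1 - 2 * M / ρ) / ρ ^ 3) (r u v), ?_, ?_⟩
  · exact hgd.hasDerivAt.comp u (hr.hasDerivAt_fst u v)
  · exact hgd.hasDerivAt.comp v (hr.hasDerivAt_snd u v)

end IsEFAreaRadius

namespace IsRadiationFieldOnSchwarzschild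

variable {M : ℝ} {r ψ : ℝ → ℝ → ℝ} {v₁ : ℝ}

/-- **`T = ∂ᵤ + ∂ᵥ` commutes with the wave equation** ("since `T` also commutes with the wave
equation", Kehrberger, proof of Thm. 6.2): if `ψ` is a smooth radiation field, so is
`Tψ = ∂ᵤψ + ∂ᵥψ`. Indeed `∂ᵤ∂ᵥ(∂ᵤψ + ∂ᵥψ) = ∂ᵤ(∂ᵤ∂ᵥψ) + ∂ᵥ(∂ᵤ∂ᵥψ) = ∂ᵤ(Vψ) + ∂ᵥ(Vψ) = (TV)ψ + V Tψ`
by Schwarz's theorem applied to `ψ` and to `∂ᵥψ`, and `TV = 0`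
(`IsEFAreaRadius.hasDerivAt_efPotential`).
[cite: Kehrberger2022AHP, proof of Thm. 6.2 (after eq. (6.23))] -/
theorem timeDeriv (hM : 0 < M) (hr : IsEFAreaRadius M r)
    (hψ : IsRadiationFieldOnSchwarzschild M r ψ) :
    IsRadiationFieldOnSchwarzschild M r (fun u v ↦ partialU ψ u v + partialV ψ u v) := by
  refine ⟨?_, fun u v ↦ ?_⟩
  · have h : Function.uncurry (fun u v ↦ partialU ψ u v + partialV ψ u v) =
        Function.uncurry (partialU ψ) + Function.uncurry (partialV ψ) := by
      funext p; rfl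
    rw [h]
    exact (contDiff_partialU hψ.1).add (contDiff_partialV hψ.1)
  · -- the inner `v`-derivative, as a function of `u'`
    have hinner : (fun u' ↦ deriv (fun v' ↦ partialU ψ u' v' + partialV ψ u' v') v) =
        fun u' ↦ efPotential M r u' v * ψ u' v + partialV (partialV ψ) u' v := by
      funext u'
      have h : HasDerivAt (fun v' ↦ partialU ψ u' v' + partialV ψ u' v')
          (partialV (partialU ψ) u' v + partialV (partialV ψ) u' v) v :=
        (hasDerivAt_partialV (contDiff_partialU hψ.1) u' v).add
          (hasDerivAt_partialV (contDiff_partialV hψ.1) u' v)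
      rw [h.deriv, ← partialU_partialV_comm hψ.1 u' v, hψ.partialU_partialV]
    simp only []
    rw [hinner]
    -- the outer `u`-derivative
    obtain ⟨d, hVu, hVv⟩ := hr.hasDerivAt_efPotential hM.le u v
    have hψu : HasDerivAt (fun u' ↦ ψ u' v) (partialU ψ u v) u := hasDerivAt_partialU hψ.1 u v
    have h3 : HasDerivAt (fun u' ↦ partialV (partialV ψ) u' v)
        (partialU (partialV (partialV ψ)) u v) u :=
      hasDerivAt_partialU (contDiff_partialV (contDiff_partialV hψ.1)) u v
    have hall : HasDerivAt (fun u' ↦ efPotential M r u' v * ψ u' v + partialV (partialV ψ) u' v)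
        (d * -(1 - 2 * M / r u v) * ψ u v + efPotential M r u v * partialU ψ u v +
          partialU (partialV (partialV ψ)) u v) u :=
      (hVu.mul hψu).add h3
    rw [hall.deriv]
    -- `∂ᵤ∂ᵥ(∂ᵥψ) = ∂ᵥ(∂ᵤ∂ᵥψ) = ∂ᵥ(Vψ)`
    have h4 : partialU (partialV (partialV ψ)) u v =
        d * (1 - 2 * M / r u v) * ψ u v + efPotential M r u v * partialV ψ u v := by
      rw [partialU_partialV_comm (contDiff_partialV hψ.1) u v]
      have hfun : (fun v' ↦ partialU (partialV ψ) u v') = fun v' ↦ efPotential M r u v' * ψ u v' :=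
        funext fun v' ↦ hψ.partialU_partialV u v'
      show deriv (fun v' ↦ partialU (partialV ψ) u v') v = _
      rw [hfun]
      have hψv : HasDerivAt (fun v' ↦ ψ u v') (partialV ψ u v) v := hasDerivAt_partialV hψ.1 u v
      have hprod : HasDerivAt (fun v' ↦ efPotential M r u v' * ψ u v')
          (d * (1 - 2 * M / r u v) * ψ u v + efPotential M r u v * partialV ψ u v) v :=
        hVv.mul hψv
      rw [hprod.deriv]
    rw [h4]
    simp only [efPotential]
    ring

/-- A function vanishing on `{v ≤ v₁}` has `∂ᵤψ = 0` there. [folklore] -/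
lemma partialU_eq_zero_of_le (hz : ∀ u v, v ≤ v₁ → ψ u v = 0) {v : ℝ} (hv : v ≤ v₁) (u : ℝ) :
    partialU ψ u v = 0 := by
  have h : (fun u' ↦ ψ u' v) = fun _ ↦ (0 : ℝ) := funext fun u' ↦ hz u' v hv
  rw [partialU, h, deriv_const]

/-- A smooth radiation field vanishing on `{v ≤ v₁}` has `∂ᵥψ = 0` there (on `{v < v₁}` because
the slice vanishes near `v`; at `v = v₁` by continuity of `∂ᵥψ`). [folklore] -/
lemma partialV_eq_zero_of_le (hψ : IsRadiationFieldOnSchwarzschild M r ψ)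
    (hz : ∀ u v, v ≤ v₁ → ψ u v = 0) {v : ℝ} (hv : v ≤ v₁) (u : ℝ) : partialV ψ u v = 0 := by
  have hlt : ∀ x, x < v₁ → partialV ψ u x = 0 := by
    intro x hx
    have h : (fun v' ↦ ψ u v') =ᶠ[𝓝 x] fun _ ↦ (0 : ℝ) :=
      (eventually_lt_nhds hx).mono fun v' hv' ↦ hz u v' (le_of_lt hv')
    rw [partialV, h.deriv_eq, deriv_const]
  have hclosed : IsClosed {x | partialV ψ u x = 0} :=
    isClosed_eq (hψ.continuous_partialV_snd u) continuous_const
  have hsub : Iio v₁ ⊆ {x | partialV ψ u x = 0} := fun x hx ↦ hlt x hx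
  have hmem : v ∈ closure (Iio v₁) := by
    rw [closure_Iio]
    exact hv
  exact closure_minimal hsub hclosed hmem

/-- Hence `Tψ = ∂ᵤψ + ∂ᵥψ` vanishes on `{v ≤ v₁}` as well. [folklore] -/
lemma timeDeriv_eq_zero_of_le (hψ : IsRadiationFieldOnSchwarzschild M r ψ)
    (hz : ∀ u v, v ≤ v₁ → ψ u v = 0) (u v : ℝ) (hv : v ≤ v₁) :
    partialU ψ u v + partialV ψ u v = 0 := by
  rw [partialU_eq_zero_of_le hz hv u, hψ.partialV_eq_zero_of_le hz hv u, add_zero]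

/-- `∂ᵥ(∂ᵤψ) = Vψ` as a derivative statement along outgoing null lines (Schwarz + the equation).
[folklore] -/
lemma hasDerivAt_partialU_snd (hψ : IsRadiationFieldOnSchwarzschild M r ψ) (u x : ℝ) :
    HasDerivAt (fun x' ↦ partialU ψ u x') (efPotential M r u x * ψ u x) x := by
  have h := hasDerivAt_partialV (contDiff_partialU hψ.1) u x
  rwa [← partialU_partialV_comm hψ.1 u x, hψ.partialU_partialV] at h

/-- **Decay of `∂ᵤψ` towards `𝓘⁻` for a past-bounded radiation field vanishing on `{v ≤ v₁}`.**
If `|ψ| ≤ B` on `{u ≤ u₀, v' ≤ v}`, then `|∂ᵤψ(u, v)| ≤ (2M/r(u,v₁)³) B (v − v₁)` for `u ≤ u₀`,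
`v ≥ v₁` (mean value inequality for `x ↦ ∂ᵤψ(u, x)` on `[v₁, v]`, whose derivative `Vψ` is bounded
by `K(u) B`, `K = efPotentialBound`, and which vanishes at `x = v₁`). [folklore] -/
lemma abs_partialU_le (hM : 0 < M) (hr : IsEFAreaRadius M r)
    (hψ : IsRadiationFieldOnSchwarzschild M r ψ) (hz : ∀ u v, v ≤ v₁ → ψ u v = 0)
    {u₀ v B : ℝ} (hB : ∀ u, u ≤ u₀ → ∀ v', v' ≤ v → |ψ u v'| ≤ B) (hv : v₁ ≤ v) {u : ℝ}
    (hu : u ≤ u₀) : |partialU ψ u v| ≤ efPotentialBound M r v₁ u * B * (v - v₁) := by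
  have hB0 : 0 ≤ B := (abs_nonneg _).trans (hB u hu v le_rfl)
  have key := norm_image_sub_le_of_norm_deriv_le_segment' (f := fun x ↦ partialU ψ u x)
    (f' := fun x ↦ efPotential M r u x * ψ u x) (a := v₁) (b := v)
    (C := efPotentialBound M r v₁ u * B)
    (fun x _ ↦ (hψ.hasDerivAt_partialU_snd u x).hasDerivWithinAt) (fun x hx ↦ ?_) v
    ⟨hv, le_rfl⟩
  · simpa only [partialU_eq_zero_of_le hz le_rfl u, sub_zero, Real.norm_eq_abs] using key
  · rw [Real.norm_eq_abs, abs_mul]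
    exact mul_le_mul (abs_efPotential_le_bound hM hr u hx.1) (hB u hu x hx.2.le) (abs_nonneg _)
      (efPotentialBound_nonneg hM hr u)

end IsRadiationFieldOnSchwarzschild

/-- `K(u) = 2M/r(u, v₁)³ → 0` as `u → −∞` (`r → ∞` towards `𝓘⁻`). [folklore] -/
lemma tendsto_efPotentialBound_atBot {M : ℝ} {r : ℝ → ℝ → ℝ} (hM : 0 < M)
    (hr : IsEFAreaRadius M r) (v₁ : ℝ) :
    Tendsto (efPotentialBound M r v₁) atBot (𝓝 0) := by
  have h3 : Tendsto (fun u ↦ r u v₁ ^ 3) atBot atTop :=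
    (tendsto_pow_atTop (by norm_num)).comp (hr.tendsto_atBot hM.le v₁)
  have h := h3.inv_tendsto_atTop.const_mul (2 * M)
  rw [mul_zero] at h
  refine h.congr fun u ↦ ?_
  simp [efPotentialBound, div_eq_mul_inv]

/-! ### The data of `T(rφ^T)` on `𝓘⁻` -/

namespace IsScatteringSolution

variable {M : ℝ} {r : ℝ → ℝ → ℝ} {v₁ : ℝ} {GT : ℝ → ℝ} {ψ : ℝ → ℝ → ℝ}

/-- **`∂ᵤ(rφ^T)(−∞, v) = 0`**: for a scattering solution, `∂ᵤψ(u, v) → 0` as `u → −∞` for every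
`v` (`IsRadiationFieldOnSchwarzschild.abs_partialU_le` with the past bound of the class and
`K(u) → 0`). [cite: Kehrberger2022AHP, proof of Thm. 6.2, eq. (6.23)] -/
theorem tendsto_partialU_atBot (hM : 0 < M) (hr : IsEFAreaRadius M r)
    (h : IsScatteringSolution M r v₁ GT ψ) (v : ℝ) :
    Tendsto (fun u ↦ partialU ψ u v) atBot (𝓝 0) := by
  have hz : ∀ u v, v ≤ v₁ → ψ u v = 0 := fun u v hv ↦ h.eq_zero hv
  rcases le_or_gt v v₁ with hv | hv
  · have hfun : (fun u ↦ partialU ψ u v) = fun _ ↦ 0 :=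
      funext fun u ↦ IsRadiationFieldOnSchwarzschild.partialU_eq_zero_of_le hz hv u
    rw [hfun]
    exact tendsto_const_nhds
  · obtain ⟨B, hB⟩ := h.exists_bound 0 v
    have hbound : ∀ᶠ u in atBot, ‖partialU ψ u v‖ ≤ efPotentialBound M r v₁ u * B * (v - v₁) :=
      (eventually_le_atBot (0 : ℝ)).mono fun u hu ↦ by
        rw [Real.norm_eq_abs]
        exact h.isRadiationField.abs_partialU_le hM hr hz hB hv.le hu
    refine squeeze_zero_norm' hbound ?_
    have ht := ((tendsto_efPotentialBound_atBot hM hr v₁).mul_const B).mul_const (v - v₁)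
    simpa using ht

/-- **`∂ᵥ(rφ^T)(−∞, v) = (G^T)'(v)`**: if a scattering solution `ψ` has data `GT` on `𝓘⁻` and `GT`
has the continuous derivative `g`, then `∂ᵥψ(u, x) → g(x)` as `u → −∞` for every `x > v₁`, with
the explicit rate `|∂ᵥψ(u, x) − g(x)| ≤ W₀ P(u)` on `(−∞, u₀]` (`P = efWeight`). Proof:
`abs_le_of_primitive_tendsto_zero` with `e = ∂ᵥψ − g`, `F = ψ − GT`: `e(u', ·)` is uniformly
`W₀P(u)`-close to `e(u, ·)` for `u' ≤ u` (`abs_partialV_sub_le` with the past energy bound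
`nullSliceEnergy_bounded`), `F(u', y) − F(u', x) = ∫ₓʸ e(u', ·)`, and `F(u', y) → 0`.
[cite: Kehrberger2022AHP, proof of Thm. 6.2, eq. (6.23)] -/
theorem abs_partialV_sub_le_of_hasDerivAt (hM : 0 < M) (hr : IsEFAreaRadius M r)
    (h : IsScatteringSolution M r v₁ GT ψ) {g : ℝ → ℝ} (hg : Continuous g)
    (hGT : ∀ x, HasDerivAt GT (g x) x) {x : ℝ} (hx : v₁ < x) (u₀ : ℝ) :
    ∃ W₀, 0 ≤ W₀ ∧ ∀ u ≤ u₀, |partialV ψ u x - g x| ≤ W₀ * efWeight M r v₁ u := by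
  have hψ := h.isRadiationField
  have hz : ∀ u v, v ≤ v₁ → ψ u v = 0 := fun u v hv ↦ h.eq_zero hv
  have hb' : v₁ ≤ x + 1 := by linarith
  obtain ⟨B, -, hB⟩ := hψ.nullSliceEnergy_bounded hM hr hz hb' u₀
  set W₀ := Real.sqrt ((x + 1 - v₁) * B) with hW₀
  have hW₀0 : 0 ≤ W₀ := Real.sqrt_nonneg _
  refine ⟨W₀, hW₀0, fun u hu ↦ ?_⟩
  have hEc : ∀ u', Continuous (partialV ψ u') := fun u' ↦ hψ.continuous_partialV_snd u'
  refine abs_le_of_primitive_tendsto_zero (e := fun u' y ↦ partialV ψ u' y - g y)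
    (F := fun u' y ↦ ψ u' y - GT y) (x₀ := x) one_pos (fun u' ↦ (hEc u').sub hg)
    (fun u' hu' y hy ↦ ?_) (fun u' _ y _ ↦ ?_) (fun y _ ↦ ?_)
  · -- uniform closeness towards `𝓘⁻`
    have hy' : y ∈ Icc v₁ (x + 1) := ⟨hx.le.trans hy.1, hy.2⟩
    have hle := hψ.abs_partialV_sub_le hM hr hz hb' hB hy' hu' hu
    have hP' : 0 ≤ efWeight M r v₁ u' := efWeight_nonneg hM hr u'
    calc |partialV ψ u' y - g y - (partialV ψ u y - g y)|
        = |partialV ψ u y - partialV ψ u' y| := by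
          rw [abs_sub_comm]; ring_nf
      _ ≤ W₀ * (efWeight M r v₁ u - efWeight M r v₁ u') := hle
      _ ≤ W₀ * efWeight M r v₁ u := by nlinarith
  · -- primitives
    have h1 : ∫ t in x..y, partialV ψ u' t = ψ u' y - ψ u' x :=
      intervalIntegral.integral_eq_sub_of_hasDerivAt (fun t _ ↦ hasDerivAt_partialV hψ.1 u' t)
        ((hEc u').intervalIntegrable _ _)
    have h2 : ∫ t in x..y, g t = GT y - GT x :=
      intervalIntegral.integral_eq_sub_of_hasDerivAt (fun t _ ↦ hGT t) (hg.intervalIntegrable _ _)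
    rw [intervalIntegral.integral_sub ((hEc u').intervalIntegrable _ _) (hg.intervalIntegrable _ _),
      h1, h2]
    ring
  · -- the data clause
    have ht := (h.tendsto_atBot y).sub_const (GT y)
    rwa [sub_self] at ht

/-- **`∂ᵥ(rφ^T)(−∞, v) = (G^T)'(v)`** as a limit: for a scattering solution `ψ` with data `GT` on
`𝓘⁻`, `(GT)' = g` continuous, `∂ᵥψ(u, x) → g(x)` as `u → −∞` for every `x > v₁`
(`abs_partialV_sub_le_of_hasDerivAt` and `P(u) → 0`), and trivially for every `x ≤ v₁` at which
`g(x) = 0` (there `∂ᵥψ(·, x) = 0`). [cite: Kehrberger2022AHP, proof of Thm. 6.2, eq. (6.23)] -/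
theorem tendsto_partialV_atBot (hM : 0 < M) (hr : IsEFAreaRadius M r)
    (h : IsScatteringSolution M r v₁ GT ψ) {g : ℝ → ℝ} (hg : Continuous g)
    (hGT : ∀ x, HasDerivAt GT (g x) x) {x : ℝ} (hx : v₁ < x ∨ g x = 0) :
    Tendsto (fun u ↦ partialV ψ u x) atBot (𝓝 (g x)) := by
  have hz : ∀ u v, v ≤ v₁ → ψ u v = 0 := fun u v hv ↦ h.eq_zero hv
  rcases le_or_gt x v₁ with hxle | hxgt
  · -- `x ≤ v₁`: both sides vanish
    have hg0 : g x = 0 := by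
      rcases hx with hx | hx
      · exact absurd hx (not_lt.2 hxle)
      · exact hx
    have hfun : (fun u ↦ partialV ψ u x) = fun _ ↦ 0 :=
      funext fun u ↦ h.isRadiationField.partialV_eq_zero_of_le hz hxle u
    rw [hfun, hg0]
    exact tendsto_const_nhds
  · obtain ⟨W₀, -, hW⟩ := h.abs_partialV_sub_le_of_hasDerivAt hM hr hg hGT hxgt 0
    have hbound : ∀ᶠ u in atBot, ‖partialV ψ u x - g x‖ ≤ W₀ * efWeight M r v₁ u :=
      (eventually_le_atBot (0 : ℝ)).mono fun u hu ↦ by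
        rw [Real.norm_eq_abs]
        exact hW u hu
    have ht : Tendsto (fun u ↦ W₀ * efWeight M r v₁ u) atBot (𝓝 0) := by
      have h0 := (tendsto_efWeight_atBot (v₁ := v₁) hM hr).const_mul W₀
      rwa [mul_zero] at h0
    exact tendsto_sub_nhds_zero_iff.1 (squeeze_zero_norm' hbound ht)

/-- **The data of `T(rφ^T)` on `𝓘⁻`** ("`T(rφ^T)(−∞, v) = ∂ᵥ(rφ^T)(−∞, v) = (G^T)'(v) = G(v)`",
eq. (6.23)): if `ψT` is a scattering solution with data `G^T = scatteringTimeIntegral v₁ G` for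
continuous `G` vanishing on `(−∞, v₁]`, then `∂ᵤψT(u, v) + ∂ᵥψT(u, v) → G(v)` as `u → −∞`, for
every `v`. [cite: Kehrberger2022AHP, proof of Thm. 6.2, eq. (6.23)] -/
theorem tendsto_timeDeriv_atBot (hM : 0 < M) (hr : IsEFAreaRadius M r) {G : ℝ → ℝ}
    (hG : Continuous G) (hG0 : ∀ x, x ≤ v₁ → G x = 0) {ψT : ℝ → ℝ → ℝ}
    (hT : IsScatteringSolution M r v₁ (scatteringTimeIntegral v₁ G) ψT) (v : ℝ) :
    Tendsto (fun u ↦ partialU ψT u v + partialV ψT u v) atBot (𝓝 (G v)) := by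
  have hx : v₁ < v ∨ G v = 0 := by
    rcases le_or_gt v v₁ with hv | hv
    · exact Or.inr (hG0 v hv)
    · exact Or.inl hv
  have h := (hT.tendsto_partialU_atBot hM hr v).add
    (hT.tendsto_partialV_atBot hM hr hG (hasDerivAt_scatteringTimeIntegral hG v₁) hx)
  rwa [zero_add] at h

end IsScatteringSolution

/-! ### The discharge -/

/-- **The time-integral identity `rφ = T(rφ^T)` (Kehrberger, proof of Thm. 6.2, eqs. (6.22)–(6.23)),
proved**: `theorem SchwarzschildLinearScattering_timeIntegral_holds : SchwarzschildLinearScattering_timeIntegral`.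
For `M > 0`, an EF area radius `r`, smooth data `G` supported in `(v₁, v₂)` (the hypothesis
`∫ G = 0` is not needed), a scattering solution `ψ` with data `G` and a scattering solution `ψT`
with data `G^T = ∫_{v₁}^{·} G`: `T ψT = ∂ᵤψT + ∂ᵥψT` is a smooth radiation field
(`IsRadiationFieldOnSchwarzschild.timeDeriv` — "`T` also commutes with the wave equation"),
vanishes on `{v ≤ v₁}` (`timeDeriv_eq_zero_of_le`) and attains the data
`T(rφ^T)(−∞, v) = ∂ᵥ(rφ^T)(−∞, v) = (G^T)'(v) = G(v)` (`IsScatteringSolution.tendsto_timeDeriv_atBot`),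
so `T ψT = ψ` "by uniqueness" (`IsRadiationFieldOnSchwarzschild.unique`).
[cite: Kehrberger2022AHP, proof of Thm. 6.2, eqs. (6.22)–(6.23)] -/
theorem SchwarzschildLinearScattering_timeIntegral_holds :
    SchwarzschildLinearScattering_timeIntegral := by
  intro M hM r hr G v₁ v₂ _hv hG hsupp _h0 ψ ψT hψ hT u v
  have hrad : IsRadiationFieldOnSchwarzschild M r (fun u v ↦ partialU ψT u v + partialV ψT u v) :=
    hT.isRadiationField.timeDeriv hM hr
  have hzT : ∀ u v, v ≤ v₁ → ψT u v = 0 := fun u v hv ↦ hT.eq_zero hv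
  have hzero : ∀ u v, v ≤ v₁ → (fun u v ↦ partialU ψT u v + partialV ψT u v) u v = 0 :=
    fun u v hv ↦ hT.isRadiationField.timeDeriv_eq_zero_of_le hzT u v hv
  have hG0 : ∀ x, x ≤ v₁ → G x = 0 := fun x hx ↦
    eq_zero_of_tsupport_subset_Ioo hsupp (Or.inl hx)
  have hdata : ∀ v, Tendsto (fun u ↦ (fun u v ↦ partialU ψT u v + partialV ψT u v) u v) atBot
      (𝓝 (G v)) := fun v ↦
    hT.tendsto_timeDeriv_atBot hM hr hG.continuous hG0 v
  have heq : ψ = fun u v ↦ partialU ψT u v + partialV ψT u v :=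
    hψ.isRadiationField.unique hM hr hrad (fun u v huv ↦ hψ.eq_zero huv) hzero
      hψ.tendsto_atBot hdata
  have huv := congrFun (congrFun heq u) v
  exact huv

end Literature.Barriers.FinalStateConjecture

end
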